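import Mathlib.Analysis.SpecialFunctions.Gaussian.GaussianIntegral
import Mathlib.Analysis.SpecialFunctions.ImproperIntegrals
import Mathlib.Analysis.SumIntegralComparisons
import Mathlib.MeasureTheory.Integral.Gamma
import HarnessLib

/-!
# Riemann sums of the Gaussian: `∑ h e^{-(jh)²} ≈ √π/2` and `∑ h (jh)² e^{-(jh)²} ≲ √π/4`

Topic `Analysis/SpecialFunctions`. Elementary sum–integral comparisons for the Gaussian on a grid
of mesh `h`, written for the analysis of the coin-driven pseudo-Gaussian sampler in the discharge of
Aaronson–Arkhipov's Main Theorem (Theory of Computing 9 (2013), Thm. 1.3; named fact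
`Literature.Computability.QuantumComplexity.gpeSolvableInFBPPRel_NPRel_of_approxBosonSamplingOracle`):
the sampler's law on the grid `hℤ` is proportional to (a perturbation of) `e^{-(jh)²}`, and its
normalising constant and second moment have to be pinned to `√π/h` and `1/2` within `1 + O(h)`.
Everything here is proved from Mathlib (`integral_gaussian_Ioi`, the Gamma integral
`integral_rpow_mul_exp_neg_mul_rpow`, and `Mathlib.Analysis.SumIntegralComparisons`).

## Results (`h > 0`, `c > 0`, `N ≥ 1`)

* `sum_range_exp_neg_sq_succ_le` — `∑_{j<N} e^{-(h(j+1))²} ≤ √π/(2h)` (antitone Riemann sum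
  below `∫₀^∞ e^{-h²u²} du`).
* `le_sum_range_exp_neg_mul_sq` — `(√π/2 - e^{-√c N})/√c ≤ ∑_{j<N} e^{-c j²}` when `√c N ≥ 1`
  (antitone Riemann sum above `∫₀^N`, and the tail `∫_L^∞ e^{-x²} ≤ e^{-L}` for `L ≥ 1`,
  `integral_Ioi_exp_neg_sq_le`, `le_integral_exp_neg_sq`).
* `sum_range_sq_mul_exp_neg_sq_le` — `∑_{j<M} (j/N)² e^{-(j/N)²} ≤ N √π/4 + e^{-1}` for every `M`
  (mesh `h = 1/N`, so that the mode `x = 1` of the unimodal `x² e^{-x²}` is a grid point; monotone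
  Riemann sum on `[0, N]`, antitone on `[N, ∞)`, and `∫₀^∞ x² e^{-x²} dx = Γ(3/2)/2 = √π/4`,
  `integral_Ioi_sq_mul_exp_neg_sq`), with the monotonicity of `t e^{-t}` / `x² e^{-x²}` on the two
  sides of the mode (`monotoneOn_mul_exp_neg`, `antitoneOn_mul_exp_neg`, …).

## References

* E. T. Whittaker, G. N. Watson, *A Course of Modern Analysis*, 4th ed., CUP 1927, §12.2 (the
  Gamma integral) and §4.1 (integral test / Riemann sums of monotone functions). (Standard
  calculus; proved here.)
-/

namespace Literature.Analysis.SpecialFunctions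

open Real Set MeasureTheory intervalIntegral Finset

/-! ### Upper bound: `∑_{j=1}^{N} e^{-(hj)²} ≤ √π/(2h)` -/

/-- `u ↦ e^{-c u²}` is antitone on `[0, ∞)` for `c ≥ 0`. [folklore] -/
theorem antitoneOn_exp_neg_mul_sq {c : ℝ} (hc : 0 ≤ c) :
    AntitoneOn (fun u : ℝ => exp (-c * u ^ 2)) (Ici 0) := by
  intro u hu v _ huv
  apply exp_le_exp.2
  have : u ^ 2 ≤ v ^ 2 := pow_le_pow_left₀ hu huv 2
  nlinarith

/-- **Upper Riemann bound**: for `h > 0` and every `N`,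
`∑_{j<N} e^{-(h(j+1))²} ≤ ∫₀^∞ e^{-h²u²} du = √π/(2h)`. [folklore] -/
theorem sum_range_exp_neg_sq_succ_le {h : ℝ} (hh : 0 < h) (N : ℕ) :
    ∑ j ∈ Finset.range N, exp (-(h * (j + 1)) ^ 2) ≤ √π / (2 * h) := by
  have hc : 0 < h ^ 2 := by positivity
  have hanti : AntitoneOn (fun u : ℝ => exp (-(h ^ 2) * u ^ 2)) (Icc 0 (N : ℝ)) :=
    (antitoneOn_exp_neg_mul_sq hc.le).mono Icc_subset_Ici_self
  have hint : IntegrableOn (fun u : ℝ => exp (-(h ^ 2) * u ^ 2)) (Ioi 0) :=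
    (integrable_exp_neg_mul_sq hc).integrableOn
  have hsum := hanti.sum_range_le_integral hint fun t _ => (exp_pos _).le
  have hval : ∫ x in Ioi (0 : ℝ), exp (-(h ^ 2) * x ^ 2) = √π / (2 * h) := by
    rw [integral_gaussian_Ioi, sqrt_div' _ hc.le, sqrt_sq hh.le]
    ring
  calc ∑ j ∈ Finset.range N, exp (-(h * (j + 1)) ^ 2)
      = ∑ j ∈ Finset.range N, exp (-(h ^ 2) * ((j + 1 : ℕ) : ℝ) ^ 2) := by
        refine Finset.sum_congr rfl fun j _ => ?_
        push_cast
        ring_nf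
    _ ≤ ∫ x in Ioi (0 : ℝ), exp (-(h ^ 2) * x ^ 2) := hsum
    _ = √π / (2 * h) := hval

/-! ### Lower bound: `∑_{j<N} e^{-c j²} ≥ (√π/2 - e^{-√c N})/√c` -/

/-- The Gaussian tail beyond `L ≥ 1` is at most `e^{-L}` (compare `e^{-x²} ≤ e^{-x}` for
`x ≥ 1`). [folklore] -/
theorem integral_Ioi_exp_neg_sq_le {L : ℝ} (hL : 1 ≤ L) :
    ∫ x in Ioi L, exp (-x ^ 2) ≤ exp (-L) := by
  rw [← integral_exp_neg_Ioi L]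
  refine setIntegral_mono_on ?_ (integrableOn_exp_neg_Ioi L) measurableSet_Ioi fun x hx => ?_
  · have := (integrable_exp_neg_mul_sq zero_lt_one).integrableOn (s := Ioi L)
    simpa using this
  · apply exp_le_exp.2
    have hx1 : 1 ≤ x := hL.trans (le_of_lt hx)
    nlinarith

/-- `∫₀^L e^{-x²} dx ≥ √π/2 - e^{-L}` for `L ≥ 1`. [folklore] -/
theorem le_integral_exp_neg_sq {L : ℝ} (hL : 1 ≤ L) :
    √π / 2 - exp (-L) ≤ ∫ x in (0 : ℝ)..L, exp (-x ^ 2) := by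
  have hL0 : (0 : ℝ) ≤ L := zero_le_one.trans hL
  have hint : Integrable (fun x : ℝ => exp (-x ^ 2)) := by
    simpa using integrable_exp_neg_mul_sq zero_lt_one
  have htot : ∫ x in Ioi (0 : ℝ), exp (-x ^ 2) = √π / 2 := by
    have := integral_gaussian_Ioi 1
    simpa using this
  have hsplit : ∫ x in Ioi (0 : ℝ), exp (-x ^ 2) =
      (∫ x in (0 : ℝ)..L, exp (-x ^ 2)) + ∫ x in Ioi L, exp (-x ^ 2) := by
    rw [intervalIntegral.integral_of_le hL0, ← setIntegral_union (Ioc_disjoint_Ioi_same)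
      measurableSet_Ioi hint.integrableOn hint.integrableOn, Ioc_union_Ioi_eq_Ioi hL0]
  have htail := integral_Ioi_exp_neg_sq_le hL
  linarith

/-- **Lower Riemann bound**: for `c > 0` and `√c · N ≥ 1`,
`(√π/2 - e^{-√c N})/√c ≤ ∫₀^N e^{-c u²} du ≤ ∑_{j<N} e^{-c j²}`. [folklore] -/
theorem le_sum_range_exp_neg_mul_sq {c : ℝ} (hc : 0 < c) (N : ℕ) (hL : 1 ≤ √c * N) :
    (√π / 2 - exp (-(√c * N))) / √c ≤ ∑ j ∈ Finset.range N, exp (-c * (j : ℝ) ^ 2) := by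
  have hsc : 0 < √c := sqrt_pos.2 hc
  have hanti : AntitoneOn (fun u : ℝ => exp (-c * u ^ 2)) (Icc (0 : ℝ) ((0 : ℝ) + N)) :=
    (antitoneOn_exp_neg_mul_sq hc.le).mono (by rw [zero_add]; exact Icc_subset_Ici_self)
  have h1 := hanti.integral_le_sum
  simp only [zero_add] at h1
  -- change variables `x = √c u`
  have hcv : ∫ u in (0 : ℝ)..N, exp (-c * u ^ 2) = (√c)⁻¹ * ∫ x in (0 : ℝ)..√c * N, exp (-x ^ 2) := by
    have := intervalIntegral.integral_comp_mul_left (fun x : ℝ => exp (-x ^ 2)) hsc.ne' (a := 0)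
      (b := (N : ℝ))
    simp only [mul_zero, smul_eq_mul] at this
    rw [← this]
    refine intervalIntegral.integral_congr fun u _ => ?_
    simp [mul_pow, sq_sqrt hc.le]
  have h2 := le_integral_exp_neg_sq hL
  calc (√π / 2 - exp (-(√c * N))) / √c ≤ (√c)⁻¹ * ∫ x in (0 : ℝ)..√c * N, exp (-x ^ 2) := by
        rw [div_eq_inv_mul]
        exact mul_le_mul_of_nonneg_left h2 (inv_nonneg.2 hsc.le)
    _ = ∫ u in (0 : ℝ)..N, exp (-c * u ^ 2) := hcv.symm
    _ ≤ ∑ j ∈ Finset.range N, exp (-c * (j : ℝ) ^ 2) := h1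

/-! ### The second moment: `∑_{j<M} (j/N)² e^{-(j/N)²} ≤ N √π/4 + e^{-1}` -/

/-- `t ↦ t e^{-t}` is monotone on `[0, 1]`. [folklore] -/
theorem monotoneOn_mul_exp_neg : MonotoneOn (fun t : ℝ => t * exp (-t)) (Icc 0 1) := by
  have hderiv : ∀ x : ℝ, HasDerivAt (fun t : ℝ => t * exp (-t)) ((1 - x) * exp (-x)) x := by
    intro x
    have h : HasDerivAt (fun t : ℝ => t * exp (-t)) (1 * exp (-x) + x * (exp (-x) * -1)) x :=
      (hasDerivAt_id' x).mul ((hasDerivAt_neg x).exp)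
    exact h.congr_deriv (by ring)
  refine monotoneOn_of_deriv_nonneg (convex_Icc 0 1) ?_ ?_ ?_
  · exact (continuous_id.mul (continuous_exp.comp continuous_neg)).continuousOn
  · exact fun x _ => (hderiv x).differentiableAt.differentiableWithinAt
  · intro x hx
    rw [interior_Icc] at hx
    rw [(hderiv x).deriv]
    exact mul_nonneg (by linarith [hx.2]) (exp_pos _).le

/-- `t ↦ t e^{-t}` is antitone on `[1, ∞)`. [folklore] -/
theorem antitoneOn_mul_exp_neg : AntitoneOn (fun t : ℝ => t * exp (-t)) (Ici 1) := by
  have hderiv : ∀ x : ℝ, HasDerivAt (fun t : ℝ => t * exp (-t)) ((1 - x) * exp (-x)) x := by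
    intro x
    have h : HasDerivAt (fun t : ℝ => t * exp (-t)) (1 * exp (-x) + x * (exp (-x) * -1)) x :=
      (hasDerivAt_id' x).mul ((hasDerivAt_neg x).exp)
    exact h.congr_deriv (by ring)
  refine antitoneOn_of_deriv_nonpos (convex_Ici 1) ?_ ?_ ?_
  · exact (continuous_id.mul (continuous_exp.comp continuous_neg)).continuousOn
  · exact fun x _ => (hderiv x).differentiableAt.differentiableWithinAt
  · intro x hx
    rw [interior_Ici] at hx
    rw [(hderiv x).deriv]
    exact mul_nonpos_of_nonpos_of_nonneg (by linarith [(Set.mem_Ioi.1 hx).le]) (exp_pos _).le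

/-- `x ↦ x² e^{-x²}` is monotone on `[0, 1]`. [folklore] -/
theorem monotoneOn_sq_mul_exp_neg_sq :
    MonotoneOn (fun x : ℝ => x ^ 2 * exp (-x ^ 2)) (Icc 0 1) := by
  intro x hx y hy hxy
  have hx2 : x ^ 2 ∈ Icc (0 : ℝ) 1 := ⟨sq_nonneg _, by nlinarith [hx.1, hx.2]⟩
  have hy2 : y ^ 2 ∈ Icc (0 : ℝ) 1 := ⟨sq_nonneg _, by nlinarith [hy.1, hy.2]⟩
  exact monotoneOn_mul_exp_neg hx2 hy2 (pow_le_pow_left₀ hx.1 hxy 2)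

/-- `x ↦ x² e^{-x²}` is antitone on `[1, ∞)`. [folklore] -/
theorem antitoneOn_sq_mul_exp_neg_sq :
    AntitoneOn (fun x : ℝ => x ^ 2 * exp (-x ^ 2)) (Ici 1) := by
  intro x hx y hy hxy
  have hx1 : (1 : ℝ) ≤ x := hx
  have hy1 : (1 : ℝ) ≤ y := hy
  have hx2 : x ^ 2 ∈ Ici (1 : ℝ) := by change 1 ≤ x ^ 2; nlinarith
  have hy2 : y ^ 2 ∈ Ici (1 : ℝ) := by change 1 ≤ y ^ 2; nlinarith
  exact antitoneOn_mul_exp_neg hx2 hy2 (pow_le_pow_left₀ (zero_le_one.trans hx1) hxy 2)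

/-- `∫₀^∞ x² e^{-x²} dx = √π/4` (`= Γ(3/2)/2`). [folklore] -/
theorem integral_Ioi_sq_mul_exp_neg_sq :
    ∫ x in Ioi (0 : ℝ), x ^ 2 * exp (-x ^ 2) = √π / 4 := by
  have h := integral_rpow_mul_exp_neg_mul_rpow (p := 2) (q := 2) (b := 1) two_pos (by norm_num)
    one_pos
  have hcongr : ∫ x in Ioi (0 : ℝ), x ^ 2 * exp (-x ^ 2) =
      ∫ x in Ioi (0 : ℝ), x ^ (2 : ℝ) * exp (-1 * x ^ (2 : ℝ)) := by
    refine setIntegral_congr_fun measurableSet_Ioi fun x _ => ?_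
    simp
  rw [hcongr, h, Real.one_rpow, one_mul, show ((2 : ℝ) + 1) / 2 = (1 : ℕ) + 1 / 2 by norm_num,
    Real.Gamma_nat_add_half 1]
  simp
  ring

/-- The integrand `x² e^{-x²}` is integrable on `(0, ∞)`. [folklore] -/
theorem integrableOn_sq_mul_exp_neg_sq :
    IntegrableOn (fun x : ℝ => x ^ 2 * exp (-x ^ 2)) (Ioi 0) := by
  have h := integrableOn_rpow_mul_exp_neg_mul_sq (b := 1) one_pos (s := 2) (by norm_num)
  refine h.congr_fun (fun x _ => ?_) measurableSet_Ioi
  simp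

/-- `∫₀^K x² e^{-x²} dx ≤ √π/4` for every `K ≥ 0`. [folklore] -/
theorem integral_sq_mul_exp_neg_sq_le {K : ℝ} (hK : 0 ≤ K) :
    ∫ x in (0 : ℝ)..K, x ^ 2 * exp (-x ^ 2) ≤ √π / 4 := by
  rw [intervalIntegral.integral_of_le hK, ← integral_Ioi_sq_mul_exp_neg_sq]
  exact setIntegral_mono_set integrableOn_sq_mul_exp_neg_sq
    (ae_of_all _ fun x => by positivity) Ioc_subset_Ioi_self.eventuallyLE

/-- **The second-moment Riemann sum**: for `N ≥ 1` and every `M`,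
`∑_{j<M} (j/N)² e^{-(j/N)²} ≤ N √π/4 + e^{-1}` — split at the mode `j = N` of the unimodal
`x² e^{-x²}` into a monotone and an antitone Riemann sum. [folklore] -/
theorem sum_range_sq_mul_exp_neg_sq_le {N : ℕ} (hN : 0 < N) (M : ℕ) :
    ∑ j ∈ Finset.range M, ((j : ℝ) / N) ^ 2 * exp (-((j : ℝ) / N) ^ 2) ≤
      N * (√π / 4) + exp (-1) := by
  set g : ℝ → ℝ := fun x => x ^ 2 * exp (-x ^ 2) with hg
  set G : ℝ → ℝ := fun u => g (u / N) with hG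
  have hNR : (0 : ℝ) < N := by exact_mod_cast hN
  have hg0 : ∀ x, 0 ≤ g x := fun x => by positivity
  have hGcont : Continuous G := by
    simp only [hG, hg]
    fun_prop
  -- monotone / antitone pieces of `G`
  have hGmono : MonotoneOn G (Icc ((0 : ℕ) : ℝ) N) := by
    rw [Nat.cast_zero]
    intro u hu v hv huv
    simp only [hG]
    refine monotoneOn_sq_mul_exp_neg_sq ⟨div_nonneg hu.1 hNR.le, ?_⟩ ⟨div_nonneg hv.1 hNR.le, ?_⟩
      (div_le_div_of_nonneg_right huv hNR.le)
    · exact (div_le_one hNR).2 hu.2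
    · exact (div_le_one hNR).2 hv.2
  have hGanti : AntitoneOn G (Ici (N : ℝ)) := by
    intro u hu v _ huv
    simp only [hG]
    have hu' : (N : ℝ) ≤ u := hu
    refine antitoneOn_sq_mul_exp_neg_sq ?_ ?_ (div_le_div_of_nonneg_right huv hNR.le)
    · exact (one_le_div hNR).2 hu'
    · exact (one_le_div hNR).2 (hu'.trans huv)
  -- reduce to `M' = max M (N+1)`
  set M' := max M (N + 1) with hM'
  have hMM' : M ≤ M' := le_max_left _ _
  have hNM' : N + 1 ≤ M' := le_max_right _ _
  change ∑ j ∈ Finset.range M, G j ≤ N * (√π / 4) + exp (-1)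
  have hmono : ∑ j ∈ Finset.range M, G j ≤ ∑ j ∈ Finset.range M', G j :=
    Finset.sum_le_sum_of_subset_of_nonneg (Finset.range_mono hMM') fun j _ _ => hg0 _
  refine hmono.trans ?_
  -- split the range at `N`
  have hsplit : ∑ j ∈ Finset.range M', G j =
      (∑ j ∈ Finset.Ico 0 N, G j) + G N + ∑ i ∈ Finset.Ico N (M' - 1), G ↑(i + 1) := by
    rw [Finset.range_eq_Ico, ← Finset.sum_Ico_consecutive _ (Nat.zero_le N) (by omega : N ≤ M'),
      Finset.sum_eq_sum_Ico_succ_bot (by omega : N < M'), add_assoc]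
    congr 2
    rw [Finset.sum_Ico_add' (fun x : ℕ => G (x : ℝ)) N (M' - 1) 1, Nat.sub_add_cancel (by omega)]
  -- the three pieces
  have h1 : ∑ j ∈ Finset.Ico 0 N, G j ≤ ∫ u in ((0 : ℕ) : ℝ)..N, G u :=
    hGmono.sum_le_integral_Ico (Nat.zero_le N)
  have h2 : G N = exp (-1) := by
    simp [hG, hg, div_self hNR.ne']
  have h3 : ∑ i ∈ Finset.Ico N (M' - 1), G ↑(i + 1) ≤ ∫ u in (N : ℝ)..((M' - 1 : ℕ) : ℝ), G u :=
    AntitoneOn.sum_le_integral_Ico (by omega : N ≤ M' - 1) (hGanti.mono Icc_subset_Ici_self)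
  have hK : (0 : ℝ) ≤ ((M' - 1 : ℕ) : ℝ) := Nat.cast_nonneg _
  have hadj : (∫ u in ((0 : ℕ) : ℝ)..N, G u) + ∫ u in (N : ℝ)..((M' - 1 : ℕ) : ℝ), G u =
      ∫ u in (0 : ℝ)..((M' - 1 : ℕ) : ℝ), G u := by
    rw [Nat.cast_zero]
    exact intervalIntegral.integral_add_adjacent_intervals (hGcont.intervalIntegrable _ _)
      (hGcont.intervalIntegrable _ _)
  have h4 : ∫ u in (0 : ℝ)..((M' - 1 : ℕ) : ℝ), G u ≤ N * (√π / 4) := by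
    have hcv : ∫ u in (0 : ℝ)..((M' - 1 : ℕ) : ℝ), G u =
        (N : ℝ) * ∫ x in (0 : ℝ) / N..((M' - 1 : ℕ) : ℝ) / N, g x := by
      simp only [hG]
      rw [intervalIntegral.integral_comp_div (fun x => g x) hNR.ne', smul_eq_mul]
    rw [hcv, zero_div]
    exact mul_le_mul_of_nonneg_left (integral_sq_mul_exp_neg_sq_le (by positivity)) hNR.le
  rw [hsplit, h2]
  linarith

end Literature.Analysis.SpecialFunctions
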